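import Summits.HubbardSuperconductivity.HubbardSuperconductivity.Theses.RelocationFloor
import Summits.HubbardSuperconductivity.HubbardSuperconductivity.Theorems.FunctionFieldCertificateMesoscopicPairOrderBloch
import Literature.MathematicalPhysics.QuantumLattice.FockRelabel
import HarnessLib

/-!
# Route `RelocationFloor`, crux `B1gSignCoherence` (stmt-HubbardSuperconductivity-15377):
# the typed split `DWaveChannelSelection → TransplantNondegeneracy → BlochPairSiteDensity → B1gSignCoherence`

Support file for the deciding crux `B1gSignCoherence` (K4) of route `RelocationFloor`
(`Summits/HubbardSuperconductivity/HubbardSuperconductivity/Theses/RelocationFloor.lean`), written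
by the crux strategist for the BC2 REDIRECT of the route re-audit (K4 was judged summit-strength:
with the two modulus cruxes K3, P3 it gives the per-displacement uniform `d`-wave floor). K4 says:
at one point `(U, δ)` of the box `B = [2,5]×[1/5,3/10]`, for every normalised `(N_L, S^z=0)`-sector
ground state `ψ`, every far displacement `r` and all unit steps `e, e'`,
`2ε Σ_x Σ_τ |ψ(τ)| |φ_x(τ)| ≤ g_d(e) g_d(e') Σ_x Re⟨ψ, φ_x⟩`, `φ_x = A_{x,e}ᴴ A_{x+r,e'} ψ`,
`A_{x,u} = c_{x↑} c_{x+u,↓}`.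

This file PROVES `B1gSignCoherence_of_subs : X₁ → X₂ → X₃ → B1gSignCoherence` for the three pieces
(spelled out verbatim in the statement; they are the route's new child items)

* `X₁ = DWaveChannelSelection` — for every `(U, δ) ∈ B` and `ε > 0`, eventually in `L`, every
  normalised BLOCH sector ground state (an eigenvector of every lattice translation
  `fockTranslate v`) whose far translation-summed pair correlation
  `S = Σ_x Re⟨ψ, A_{x,e}ᴴ A_{x+r,e'} ψ⟩` is comparable to the transplant mass
  (`2ε Q ≤ |S|`, `Q = Σ_x ‖A_{x,e}ᴴ A_{x+r,e'} ψ‖²`, a four-point DENSITY correlation) has the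
  `B1g` sign: `0 ≤ g_d(e) g_d(e') S` — the SYMMETRY CHANNEL of the condensate, no magnitude;
* `X₂ = TransplantNondegeneracy` — at SOME `(U, δ) ∈ B`: `2ε Q ≤ |S|` for Bloch ground states and
  far `r` — a COHERENT FRACTION of the transplant mass survives in the pair correlation, sign and
  channel unspecified (a pair-density wave or an `s±` pattern would still satisfy it);
* `X₃ = BlochPairSiteDensity` — on `B`: `p₀ L² ≤ Q` for Bloch ground states and far `r` (the
  translation-summed, Bloch-only form of the route's crux `PairSiteDensity`).

Assembly (`sign_coherence_of_bloch_forms`, NOT a conjunction seam): (i) at the point of `X₂`,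
`X₁ ∧ X₂` give `2ε Q_φ ≤ g g' S_φ` for BLOCH ground states `φ` only; both sides are expectations
of the translation-invariant operators `H_q = Σ_x T_xᴴ T_x`, `H_s = Σ_x T_x` (`T_x = A_{x,e}ᴴ A_{x+r,e'}`),
so the inequality is `Re⟨φ, X φ⟩ ≥ 0` for the Hermitian translation-invariant form
`X = g g' (H_s + H_sᴴ) - 4ε H_q`; (ii) VARIATIONAL BLOCH REDUCTION (`le_re_of_bloch`, reusing
`exists_unit_common_eigenvector_isMinOn` of `FunctionFieldCertificateMesoscopicPairOrderBlochAbstract`):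
the minimum of `Re⟨ψ, X ψ⟩` over the unit sphere of the (translation-invariant) sector ground
eigenspace is attained at a joint eigenvector of the two unit translations, i.e. at a Bloch ground
state, so `Re⟨ψ, X ψ⟩ ≥ 0` for EVERY ground state — momentum-mixed members of a degenerate
eigenspace included; the same reduction turns `X₃` into `p₀ L² ≤ Q_ψ` for every ground state;
(iii) Cauchy–Schwarz twice, `Σ_x Σ_τ |ψ||T_x ψ| ≤ Σ_x ‖T_x ψ‖ ≤ L (Σ_x ‖T_x ψ‖²)^{1/2} ≤ Q_ψ/√p₀`,
gives K4 with `ε' = ε √p₀`, `R = R₁ + R₂ + R₃`, `L₀ = L₁ + L₂ + L₃`.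

Why the cut is honest: `X₁` carries the sign pattern but no magnitude (it is vacuous where pair
correlations decay, e.g. at `U = 0` by Wick), `X₂` carries a magnitude but no channel (it does
not give the `d`-wave order functional a sign-definite far part), `X₃` is a density statement;
none implies K4 or the summit by itself, and all three enter the proof.

H. Tasaki, *Physics and Mathematics of Quantum Many-Body Systems* (2020) §2.1 (variational
principle), §4.1 (translation invariance, momentum eigenstates); D. J. Scalapino, Phys. Rep. 250
(1995) 329, §2 (pair field, `B1g` form factor); C. N. Yang, Rev. Mod. Phys. 34 (1962) 694, §3
(Gram forms `⟨ψ, Xᴴ Y ψ⟩`). No definition is introduced; everything is proved.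
-/

noncomputable section

-- the summit namespace `Summit.HubbardSuperconductivity.HubbardSuperconductivity.…` repeats the problem name by design (D-0017)
set_option linter.dupNamespace false

namespace Summit.HubbardSuperconductivity.HubbardSuperconductivity.Theorems.RelocationFloor

open Matrix Finset
open Literature.Probability.LatticeModels Literature.MathematicalPhysics.QuantumLattice
open Summit.HubbardSuperconductivity.HubbardSuperconductivity.Theses.RelocationFloor
open Summit.HubbardSuperconductivity.HubbardSuperconductivity.Theorems.FunctionFieldCertificate
  (exists_unit_common_eigenvector_isMinOn fockTranslate_mulVec_mem_ground
    forall_fockTranslate_mulVec_eq_smul_of_generators conjTranspose_fockTranslate_val fockTranslate_add_val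
    dotProduct_mulVec_eq_star_conjTranspose_mulVec_dotProduct star_dotProduct_conjTranspose_mul_mulVec)
open scoped ComplexOrder

/-! ### §1 Model-free pieces: norms and Cauchy–Schwarz in the occupation basis -/

section Norms

variable {n : Type*} [Fintype n]

/-- `Re ⟨a, a⟩ = Σ_τ ‖a τ‖²`. [folklore] -/
theorem re_star_dotProduct_self_eq_sum (a : n → ℂ) :
    (star a ⬝ᵥ a).re = ∑ τ, ‖a τ‖ ^ 2 := by
  simp only [dotProduct, Pi.star_apply, Complex.re_sum, Complex.star_def, Complex.conj_mul',
    ← Complex.ofReal_pow, Complex.ofReal_re]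

/-- **Cauchy–Schwarz in the occupation basis**: `Σ_τ ‖a τ‖ ‖b τ‖ ≤ √(Re⟨b,b⟩)` for a unit
vector `a`. [folklore] -/
theorem sum_norm_mul_norm_le_sqrt (a b : n → ℂ) (ha : star a ⬝ᵥ a = 1) :
    ∑ τ, ‖a τ‖ * ‖b τ‖ ≤ Real.sqrt ((star b ⬝ᵥ b).re) := by
  have hcs := Finset.sum_mul_sq_le_sq_mul_sq (Finset.univ : Finset n) (fun τ => ‖a τ‖) (fun τ => ‖b τ‖)
  have ha' : ∑ τ, ‖a τ‖ ^ 2 = 1 := by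
    rw [← re_star_dotProduct_self_eq_sum, ha, Complex.one_re]
  rw [ha', one_mul, ← re_star_dotProduct_self_eq_sum] at hcs
  have h0 : 0 ≤ ∑ τ, ‖a τ‖ * ‖b τ‖ := Finset.sum_nonneg fun τ _ => mul_nonneg (norm_nonneg _) (norm_nonneg _)
  calc ∑ τ, ‖a τ‖ * ‖b τ‖ = Real.sqrt ((∑ τ, ‖a τ‖ * ‖b τ‖) ^ 2) := (Real.sqrt_sq h0).symm
    _ ≤ Real.sqrt ((star b ⬝ᵥ b).re) := Real.sqrt_le_sqrt hcs

/-- **Cauchy–Schwarz over the sites**: `Σ_x √(q x) ≤ √(#X) · √(Σ_x q x)` for `q ≥ 0`. [folklore] -/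
theorem sum_sqrt_le_sqrt_card_mul_sqrt_sum {X : Type*} [Fintype X] (q : X → ℝ) (hq : ∀ x, 0 ≤ q x) :
    ∑ x, Real.sqrt (q x) ≤ Real.sqrt (Fintype.card X) * Real.sqrt (∑ x, q x) := by
  have hcs := Finset.sum_mul_sq_le_sq_mul_sq (Finset.univ : Finset X) (fun _ => (1 : ℝ)) (fun x => Real.sqrt (q x))
  simp only [one_mul, one_pow, Finset.sum_const, Finset.card_univ, nsmul_eq_mul, mul_one] at hcs
  have hsq : ∑ x, Real.sqrt (q x) ^ 2 = ∑ x, q x := Finset.sum_congr rfl fun x _ => Real.sq_sqrt (hq x)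
  rw [hsq] at hcs
  have h0 : 0 ≤ ∑ x, Real.sqrt (q x) := Finset.sum_nonneg fun x _ => Real.sqrt_nonneg _
  calc ∑ x, Real.sqrt (q x) = Real.sqrt ((∑ x, Real.sqrt (q x)) ^ 2) := (Real.sqrt_sq h0).symm
    _ ≤ Real.sqrt ((Fintype.card X : ℝ) * ∑ x, q x) := Real.sqrt_le_sqrt hcs
    _ = Real.sqrt (Fintype.card X) * Real.sqrt (∑ x, q x) := Real.sqrt_mul (Nat.cast_nonneg _) _

/-- `Re ⟨ψ, Bᴴ ψ⟩ = Re ⟨ψ, B ψ⟩`. [folklore] -/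
theorem re_star_dotProduct_conjTranspose_mulVec (B : Matrix n n ℂ) (ψ : n → ℂ) :
    (star ψ ⬝ᵥ Bᴴ *ᵥ ψ).re = (star ψ ⬝ᵥ B *ᵥ ψ).re := by
  rw [dotProduct_mulVec_eq_star_conjTranspose_mulVec_dotProduct, conjTranspose_conjTranspose, star_dotProduct,
    Complex.star_def, Complex.conj_re]

/-- A real multiple of a Hermitian matrix is Hermitian. [folklore] -/
theorem isHermitian_ofReal_smul {m : Type*} {B : Matrix m m ℂ} (hB : B.IsHermitian) (c : ℝ) :
    ((c : ℂ) • B).IsHermitian := by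
  unfold Matrix.IsHermitian at hB ⊢
  rw [conjTranspose_smul, Complex.star_def, Complex.conj_ofReal, hB]

end Norms

/-! ### §2 The torus: Bloch reduction of a translation-invariant Hermitian form on the sector ground space -/

section Torus

variable {L : ℕ} [NeZero L]

/-- **Bloch reduction (variational form).** Let `A` be a Hermitian matrix on the Fock space of the
torus which is invariant under every lattice translation. If `b ≤ Re⟨φ, A φ⟩` for every
normalised `(N, S^z = M)`-sector ground state `φ` of `hubbardTorus 2 L t U` that is an eigenvector
of EVERY translation `fockTranslate v` (a Bloch ground state), then `b ≤ Re⟨ψ, A ψ⟩` for every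
normalised sector ground state `ψ`: the minimum of the Rayleigh quotient over the unit sphere of
the (translation-invariant) sector ground eigenspace is attained at a joint eigenvector of the two
unit translations (`exists_unit_common_eigenvector_isMinOn`). Tasaki (2020) §2.1, §4.1. [folklore] -/
theorem le_re_of_bloch (t U : ℝ) (N : ℕ) (M : ℝ) (b : ℝ)
    (A : Matrix (Finset (Orb (FermionTorus 2 L))) (Finset (Orb (FermionTorus 2 L))) ℂ)
    (hA : A.IsHermitian) (hAT : ∀ v : TorusSite 2 L, relabel (Orb.translate v) A = A)
    (h : ∀ φ : Fock (Orb (FermionTorus 2 L)), star φ ⬝ᵥ φ = 1 →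
      IsGroundStateInSector (hubbardTorus 2 L t U) N M φ →
        (∀ v : TorusSite 2 L, ∃ c : ℂ, (fockTranslate v).val *ᵥ φ = c • φ) →
          b ≤ (star φ ⬝ᵥ A *ᵥ φ).re)
    (ψ : Fock (Orb (FermionTorus 2 L))) (hψ : star ψ ⬝ᵥ ψ = 1)
    (hgs : IsGroundStateInSector (hubbardTorus 2 L t U) N M ψ) :
    b ≤ (star ψ ⬝ᵥ A *ᵥ ψ).re := by
  set H := hubbardTorus 2 L t U with hH
  set E : ℂ := ((H.minEnergyOn (szSector (Λ := FermionTorus 2 L) N M) : ℝ) : ℂ) with hEdef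
  set G : Submodule ℂ (Fock (Orb (FermionTorus 2 L))) :=
    szSector (Λ := FermionTorus 2 L) N M ⊓ Module.End.eigenspace (Matrix.toLin' H) E with hG
  have hmemG : ∀ φ : Fock (Orb (FermionTorus 2 L)),
      φ ∈ G ↔ φ ∈ szSector (Λ := FermionTorus 2 L) N M ∧ H *ᵥ φ = E • φ := fun φ => by
    rw [hG, Submodule.mem_inf, Module.End.mem_eigenspace_iff, Matrix.toLin'_apply]
  have hψG : ψ ∈ G := (hmemG ψ).2 ⟨hgs.1, hgs.2.2⟩
  set T₁ := (fockTranslate (Pi.single 0 1 : TorusSite 2 L)).val with hT₁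
  set T₂ := (fockTranslate (Pi.single 1 1 : TorusSite 2 L)).val with hT₂
  have h12 : Commute T₁ T₂ := by
    change (fockTranslate (Pi.single 0 1 : TorusSite 2 L)).val * (fockTranslate (Pi.single 1 1 : TorusSite 2 L)).val =
      (fockTranslate (Pi.single 1 1 : TorusSite 2 L)).val * (fockTranslate (Pi.single 0 1 : TorusSite 2 L)).val
    rw [← fockTranslate_add_val, ← fockTranslate_add_val, add_comm]
  have hGinv : ∀ v : TorusSite 2 L, ∀ φ ∈ G, (fockTranslate v).val *ᵥ φ ∈ G := by
    intro v φ hφ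
    obtain ⟨hφS, hφE⟩ := (hmemG φ).1 hφ
    exact (hmemG _).2 (fockTranslate_mulVec_mem_ground t U N M E v hφS hφE)
  have hGinv' : ∀ v : TorusSite 2 L, ∀ φ ∈ G, ((fockTranslate v).val)ᴴ *ᵥ φ ∈ G := by
    intro v φ hφ
    rw [conjTranspose_fockTranslate_val]
    exact hGinv (-v) φ hφ
  obtain ⟨φ, hφG, hφ1, hc₁, hc₂, hmin⟩ := exists_unit_common_eigenvector_isMinOn hA G ⟨ψ, hψG, hψ⟩
    h12 (fockRelabel_commute_of_relabel_eq _ (hAT _)) (fockRelabel_commute_of_relabel_eq _ (hAT _))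
    (hGinv _) (hGinv' _) (hGinv _) (hGinv' _)
  have hbloch := forall_fockTranslate_mulVec_eq_smul_of_generators hc₁ hc₂
  obtain ⟨hφS, hφE⟩ := (hmemG φ).1 hφG
  have hφ0 : φ ≠ 0 := by
    intro h0
    rw [h0, star_zero, zero_dotProduct] at hφ1
    exact zero_ne_one hφ1
  have hφgs : IsGroundStateInSector H N M φ := ⟨hφS, hφ0, hφE⟩
  exact (h φ hφ1 hφgs hbloch).trans (hmin ψ hψG hψ)

/-- `|Λ_L| = L²` as a real number. [folklore] -/
theorem card_torusSite_two (L : ℕ) [NeZero L] : (Fintype.card (TorusSite 2 L) : ℝ) = (L : ℝ) ^ 2 := by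
  simp only [Fintype.card_pi, ZMod.card, prod_const, card_univ, Fintype.card_fin]
  push_cast
  ring

/-- `g_d(e)² = 1` on the four unit steps (Scalapino 1995 §2 eq. (2.3)). [folklore] -/
theorem sq_dWaveFormFactor_eq_one {e : Site 2} (he : e ∈ unitSteps) : dWaveFormFactor e ^ 2 = 1 := by
  simp only [unitSteps, Finset.mem_insert, Finset.mem_singleton] at he
  rcases he with rfl | rfl | rfl | rfl
  · rw [dWaveFormFactor, if_pos (Or.inl rfl)]; norm_num
  · rw [dWaveFormFactor, if_pos (Or.inr rfl)]; norm_num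
  · rw [dWaveFormFactor, if_neg (by decide), if_pos (Or.inl rfl)]; norm_num
  · rw [dWaveFormFactor, if_neg (by decide), if_pos (Or.inr rfl)]; norm_num

/-- **Core of the assembly (one displacement, one bond-orientation pair).** Let `T_x`
(`x ∈ Λ_L`) be a translation-covariant family of matrices (`U_v T_x U_vᴴ = T_{x+v}`), `g ∈ ℝ`
(here `g = g_d(e) g_d(e') = ±1`), `ε, p₀ > 0`. Suppose every normalised BLOCH sector ground state `φ` satisfies the coherent-channel
inequality `2ε Σ_x ‖T_x φ‖² ≤ g Σ_x Re⟨φ, T_x φ⟩` and the mass floor `p₀ L² ≤ Σ_x ‖T_x φ‖²`. Then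
EVERY normalised sector ground state `ψ` satisfies the `B1g`-sign-coherence inequality
`2 ε √p₀ · Σ_x Σ_τ |ψ(τ)| |(T_x ψ)(τ)| ≤ g Σ_x Re⟨ψ, T_x ψ⟩`. Proof: both Bloch hypotheses are
non-negativity statements `Re⟨φ, X φ⟩ ≥ 0` for the translation-invariant Hermitian forms
`X₁ = g (H_s + H_sᴴ) - 4ε H_q`, `X₂ = H_q - p₀ L²` (`H_s = Σ T_x`, `H_q = Σ T_xᴴ T_x`), which pass
to every ground state by `re_nonneg_of_bloch`; then Cauchy–Schwarz twice,
`Σ_x Σ_τ |ψ||T_x ψ| ≤ Σ_x ‖T_x ψ‖ ≤ L (Σ_x ‖T_x ψ‖²)^{1/2} ≤ (Σ_x ‖T_x ψ‖²)/√p₀`. [folklore] -/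
theorem sign_coherence_of_bloch_forms (t U : ℝ) (N : ℕ) (M : ℝ)
    (T : TorusSite 2 L → Matrix (Finset (Orb (FermionTorus 2 L))) (Finset (Orb (FermionTorus 2 L))) ℂ)
    (hT : ∀ v x : TorusSite 2 L, relabel (Orb.translate v) (T x) = T (x + v))
    {ε p₀ : ℝ} (g : ℝ) (hε : 0 < ε) (hp₀ : 0 < p₀)
    (h12 : ∀ φ : Fock (Orb (FermionTorus 2 L)), star φ ⬝ᵥ φ = 1 →
      IsGroundStateInSector (hubbardTorus 2 L t U) N M φ →
        (∀ v : TorusSite 2 L, ∃ c : ℂ, (fockTranslate v).val *ᵥ φ = c • φ) →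
          2 * ε * (∑ x : TorusSite 2 L, (star (T x *ᵥ φ) ⬝ᵥ (T x *ᵥ φ)).re) ≤
            g * ∑ x : TorusSite 2 L, (star φ ⬝ᵥ (T x *ᵥ φ)).re)
    (h3 : ∀ φ : Fock (Orb (FermionTorus 2 L)), star φ ⬝ᵥ φ = 1 →
      IsGroundStateInSector (hubbardTorus 2 L t U) N M φ →
        (∀ v : TorusSite 2 L, ∃ c : ℂ, (fockTranslate v).val *ᵥ φ = c • φ) →
          p₀ * (L : ℝ) ^ 2 ≤ ∑ x : TorusSite 2 L, (star (T x *ᵥ φ) ⬝ᵥ (T x *ᵥ φ)).re)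
    (ψ : Fock (Orb (FermionTorus 2 L))) (hψ : star ψ ⬝ᵥ ψ = 1)
    (hgs : IsGroundStateInSector (hubbardTorus 2 L t U) N M ψ) :
    2 * (ε * Real.sqrt p₀) * (∑ x : TorusSite 2 L, ∑ τ : Finset (Orb (FermionTorus 2 L)), ‖ψ τ‖ * ‖(T x *ᵥ ψ) τ‖) ≤
      g * ∑ x : TorusSite 2 L, (star ψ ⬝ᵥ (T x *ᵥ ψ)).re := by
  -- the two translation-invariant operators
  set Hs : Matrix (Finset (Orb (FermionTorus 2 L))) (Finset (Orb (FermionTorus 2 L))) ℂ :=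
    ∑ x : TorusSite 2 L, T x with hHs
  set Hq : Matrix (Finset (Orb (FermionTorus 2 L))) (Finset (Orb (FermionTorus 2 L))) ℂ :=
    ∑ x : TorusSite 2 L, (T x)ᴴ * T x with hHq
  have hS : ∀ ξ : Fock (Orb (FermionTorus 2 L)),
      ∑ x : TorusSite 2 L, (star ξ ⬝ᵥ (T x *ᵥ ξ)).re = (star ξ ⬝ᵥ (Hs *ᵥ ξ)).re := fun ξ => by
    rw [hHs, Matrix.sum_mulVec, dotProduct_sum, Complex.re_sum]
  have hQ : ∀ ξ : Fock (Orb (FermionTorus 2 L)),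
      ∑ x : TorusSite 2 L, (star (T x *ᵥ ξ) ⬝ᵥ (T x *ᵥ ξ)).re = (star ξ ⬝ᵥ (Hq *ᵥ ξ)).re := fun ξ => by
    rw [hHq, Matrix.sum_mulVec, dotProduct_sum, Complex.re_sum]
    refine Finset.sum_congr rfl fun x _ => ?_
    rw [star_dotProduct_conjTranspose_mul_mulVec]
  have hHsT : ∀ v : TorusSite 2 L, relabel (Orb.translate v) Hs = Hs := fun v => by
    rw [hHs, relabel_sum]
    simp_rw [hT]
    exact Fintype.sum_equiv (Equiv.addRight v) _ _ fun x => rfl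
  have hHqT : ∀ v : TorusSite 2 L, relabel (Orb.translate v) Hq = Hq := fun v => by
    rw [hHq, relabel_sum]
    simp_rw [relabel_mul, relabel_conjTranspose, hT]
    exact Fintype.sum_equiv (Equiv.addRight v) _ _ fun x => rfl
  have hHqH : Hq.IsHermitian := by
    unfold Matrix.IsHermitian
    rw [hHq, conjTranspose_sum]
    exact Finset.sum_congr rfl fun x _ => by rw [conjTranspose_mul, conjTranspose_conjTranspose]
  -- form 1: the coherent-channel form
  set X : Matrix (Finset (Orb (FermionTorus 2 L))) (Finset (Orb (FermionTorus 2 L))) ℂ :=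
    (g : ℂ) • (Hs + Hsᴴ) - ((4 * ε : ℝ) : ℂ) • Hq with hX
  have hXH : X.IsHermitian :=
    (isHermitian_ofReal_smul (Matrix.isHermitian_add_transpose_self Hs) g).sub
      (isHermitian_ofReal_smul hHqH (4 * ε))
  have hXT : ∀ v : TorusSite 2 L, relabel (Orb.translate v) X = X := fun v => by
    rw [hX, relabel_sub, relabel_smul, relabel_smul, relabel_add, relabel_conjTranspose, hHsT, hHqT]
  have hXre : ∀ ξ : Fock (Orb (FermionTorus 2 L)), (star ξ ⬝ᵥ (X *ᵥ ξ)).re =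
      2 * (g * ∑ x : TorusSite 2 L, (star ξ ⬝ᵥ (T x *ᵥ ξ)).re) -
        4 * ε * ∑ x : TorusSite 2 L, (star (T x *ᵥ ξ) ⬝ᵥ (T x *ᵥ ξ)).re := fun ξ => by
    rw [hS, hQ, hX, sub_mulVec, smul_mulVec, smul_mulVec, add_mulVec, dotProduct_sub,
      dotProduct_smul, dotProduct_smul, dotProduct_add, smul_eq_mul, smul_eq_mul, Complex.sub_re,
      Complex.re_ofReal_mul, Complex.re_ofReal_mul, Complex.add_re, re_star_dotProduct_conjTranspose_mulVec]
    ring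
  have key1 : 0 ≤ (star ψ ⬝ᵥ (X *ᵥ ψ)).re := by
    refine le_re_of_bloch t U N M 0 X hXH hXT (fun φ hφ hφgs hb => ?_) ψ hψ hgs
    rw [hXre]
    have := h12 φ hφ hφgs hb
    linarith
  rw [hXre] at key1
  -- form 2: the mass floor
  have key2 : p₀ * (L : ℝ) ^ 2 ≤ (star ψ ⬝ᵥ (Hq *ᵥ ψ)).re :=
    le_re_of_bloch t U N M (p₀ * (L : ℝ) ^ 2) Hq hHqH hHqT
      (fun φ hφ hφgs hb => by rw [← hQ]; exact h3 φ hφ hφgs hb) ψ hψ hgs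
  rw [← hQ] at key2
  -- Cauchy–Schwarz
  set Q : ℝ := ∑ x : TorusSite 2 L, (star (T x *ᵥ ψ) ⬝ᵥ (T x *ᵥ ψ)).re with hQdef
  set S : ℝ := ∑ x : TorusSite 2 L, (star ψ ⬝ᵥ (T x *ᵥ ψ)).re with hSdef
  set Mo : ℝ := ∑ x : TorusSite 2 L, ∑ τ : Finset (Orb (FermionTorus 2 L)), ‖ψ τ‖ * ‖(T x *ᵥ ψ) τ‖ with hMo
  have hq0 : ∀ x : TorusSite 2 L, 0 ≤ (star (T x *ᵥ ψ) ⬝ᵥ (T x *ᵥ ψ)).re := fun x => by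
    rw [re_star_dotProduct_self_eq_sum]
    positivity
  have hM1 : Mo ≤ ∑ x : TorusSite 2 L, Real.sqrt ((star (T x *ᵥ ψ) ⬝ᵥ (T x *ᵥ ψ)).re) :=
    Finset.sum_le_sum fun x _ => sum_norm_mul_norm_le_sqrt ψ _ hψ
  have hM2 := sum_sqrt_le_sqrt_card_mul_sqrt_sum (fun x : TorusSite 2 L => (star (T x *ᵥ ψ) ⬝ᵥ (T x *ᵥ ψ)).re) hq0
  rw [card_torusSite_two L, Real.sqrt_sq (Nat.cast_nonneg L)] at hM2
  have hQ0 : 0 ≤ Q := le_trans (by positivity) key2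
  have hsq : Real.sqrt p₀ * (L : ℝ) ≤ Real.sqrt Q := by
    rw [← Real.sqrt_sq (Nat.cast_nonneg L), ← Real.sqrt_mul hp₀.le]
    exact Real.sqrt_le_sqrt key2
  have hM : Real.sqrt p₀ * Mo ≤ Q :=
    calc Real.sqrt p₀ * Mo ≤ Real.sqrt p₀ * ((L : ℝ) * Real.sqrt Q) :=
          mul_le_mul_of_nonneg_left (hM1.trans hM2) (Real.sqrt_nonneg _)
      _ = Real.sqrt p₀ * (L : ℝ) * Real.sqrt Q := by ring
      _ ≤ Real.sqrt Q * Real.sqrt Q := mul_le_mul_of_nonneg_right hsq (Real.sqrt_nonneg _)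
      _ = Q := Real.mul_self_sqrt hQ0
  have hfin : 2 * ε * Q ≤ g * S := by linarith
  calc 2 * (ε * Real.sqrt p₀) * Mo = 2 * ε * (Real.sqrt p₀ * Mo) := by ring
    _ ≤ 2 * ε * Q := mul_le_mul_of_nonneg_left hM (by positivity)
    _ ≤ g * S := hfin

end Torus

/-! ### §3 The split of `B1gSignCoherence` -/

/-- **BC2-redirect split of the crux `B1gSignCoherence`** (stmt-HubbardSuperconductivity-15377,
route `RelocationFloor`): `DWaveChannelSelection → TransplantNondegeneracy → BlochPairSiteDensity →
B1gSignCoherence`, the three hypotheses being spelled out verbatim (they become the route's child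
items). (1) d-WAVE CHANNEL SELECTION on the box: for every `(U, δ) ∈ [2,5]×[1/5,3/10]` and
`ε > 0`, far translation-summed pair correlations `S = Σ_x Re⟨ψ, A_{x,e}ᴴ A_{x+r,e'} ψ⟩` of a
BLOCH sector ground state that are comparable to the transplant mass
(`2ε Q ≤ |S|`, `Q = Σ_x ‖A_{x,e}ᴴ A_{x+r,e'} ψ‖²`) carry the `B1g` sign `g_d(e) g_d(e') S ≥ 0`;
(2) TRANSPLANT NON-DEGENERACY at one point of the box: `2ε Q ≤ |S|` for Bloch ground states, far
`r`; (3) BLOCH PAIR-SITE DENSITY on the box: `p₀ L² ≤ Q` for Bloch ground states, far `r`.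
Assembly = `sign_coherence_of_bloch_forms` at the point of (2): two variational Bloch reductions
(`re_nonneg_of_bloch`) and Cauchy–Schwarz give the crux with `ε' = ε √p₀`, `R = R₁ + R₂ + R₃`,
`L₀ = L₁ + L₂ + L₃`. [folklore] -/
theorem B1gSignCoherence_of_subs :
    (∀ U ∈ Set.Icc (2 : ℝ) 5, ∀ δ ∈ Set.Icc (1 / 5 : ℝ) (3 / 10), ∀ ε : ℝ, 0 < ε → ∃ R L₀ : ℕ, ∀ (L : ℕ) [NeZero L], L₀ ≤ L → Even L → ∀ ψ : Fock (Orb (FermionTorus 2 L)), star ψ ⬝ᵥ ψ = 1 → IsGroundStateInSector (hubbardTorus 2 L 1 U) (2 * ⌊(1 - δ) * (L : ℝ) ^ 2 / 2⌋₊) 0 ψ → (∀ v : TorusSite 2 L, ∃ c : ℂ, (fockTranslate v).val *ᵥ ψ = c • ψ) → ∀ r : TorusSite 2 L, R ≤ torusDist r 0 → ∀ e ∈ unitSteps, ∀ e' ∈ unitSteps, let A : TorusSite 2 L → Site 2 → Matrix (Finset (Orb (FermionTorus 2 L))) (Finset (Orb (FermionTorus 2 L))) ℂ := fun x u => annihilation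 (orb (FermionTorus.ofTorusSite x) 0) * annihilation (orb (FermionTorus.ofTorusSite (x + Torus.proj L u)) 1); let φ : TorusSite 2 L → Fock (Orb (FermionTorus 2 L)) := fun x => ((A x e)ᴴ * A (x + r) e') *ᵥ ψ; 2 * ε * (∑ x : TorusSite 2 L, (star (φ x) ⬝ᵥ φ x).re) ≤ |∑ x : TorusSite 2 L, (star ψ ⬝ᵥ φ x).re| → 0 ≤ dWaveFormFactor e * dWaveFormFactor e' * (∑ x : TorusSite 2 L, (star ψ ⬝ᵥ φ x).re)) →
    (∃ U ∈ Set.Icc (2 : ℝ) 5, ∃ δ ∈ Set.Icc (1 / 5 : ℝ) (3 / 10), ∃ ε : ℝ, 0 < ε ∧ ∃ R L₀ : ℕ, ∀ (L : ℕ) [NeZero L], L₀ ≤ L → Even L → ∀ ψ : Fock (Orb (FermionTorus 2 L)), star ψ ⬝ᵥ ψ = 1 → IsGroundStateInSector (hubbardTorus 2 L 1 U) (2 * ⌊(1 - δ) * (L : ℝ) ^ 2 / 2⌋₊) 0 ψ → (∀ v : TorusSite 2 L, ∃ c : ℂ, (fockTranslate v).val *ᵥ ψ = c • ψ) → ∀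 r : TorusSite 2 L, R ≤ torusDist r 0 → ∀ e ∈ unitSteps, ∀ e' ∈ unitSteps, let A : TorusSite 2 L → Site 2 → Matrix (Finset (Orb (FermionTorus 2 L))) (Finset (Orb (FermionTorus 2 L))) ℂ := fun x u => annihilation (orb (FermionTorus.ofTorusSite x) 0) * annihilation (orb (FermionTorus.ofTorusSite (x + Torus.proj L u)) 1); let φ : TorusSite 2 L → Fock (Orb (FermionTorus 2 L)) := fun x => ((A x e)ᴴ * A (x + r) e') *ᵥ ψ; 2 * ε * (∑ x : TorusSite 2 L, (star (φ x) ⬝ᵥ φ x).re) ≤ |∑ x : TorusSite 2 L, (star ψ ⬝ᵥ φ x).re|) →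
    (∀ U ∈ Set.Icc (2 : ℝ) 5, ∀ δ ∈ Set.Icc (1 / 5 : ℝ) (3 / 10), ∃ p₀ : ℝ, 0 < p₀ ∧ ∃ R L₀ : ℕ, ∀ (L : ℕ) [NeZero L], L₀ ≤ L → Even L → ∀ ψ : Fock (Orb (FermionTorus 2 L)), star ψ ⬝ᵥ ψ = 1 → IsGroundStateInSector (hubbardTorus 2 L 1 U) (2 * ⌊(1 - δ) * (L : ℝ) ^ 2 / 2⌋₊) 0 ψ → (∀ v : TorusSite 2 L, ∃ c : ℂ, (fockTranslate v).val *ᵥ ψ = c • ψ) → ∀ r : TorusSite 2 L, R ≤ torusDist r 0 → ∀ e ∈ unitSteps, ∀ e' ∈ unitSteps, let A : TorusSite 2 L → Site 2 → Matrix (Finset (Orb (FermionTorus 2 L))) (Finset (Orb (FermionTorus 2 L))) ℂ := fun x u => annihilation (orb (FermionTorus.ofTorusSite x) 0) * annihilation (orb (FermionTorus.ofTorusSite (x + Torus.proj L u)) 1); let φ : TorusSite 2 L → Fock (Orb (FermionTorus 2 L)) := fun x => ((A x e)ᴴ * A (x + r) e') *ᵥ ψ; p₀ * (L : ℝ) ^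 2 ≤ ∑ x : TorusSite 2 L, (star (φ x) ⬝ᵥ φ x).re) →
    B1gSignCoherence := by
  intro h1 h2 h3
  obtain ⟨U, hU, δ, hδ, ε, hε, R₂, L₂, h2⟩ := h2
  obtain ⟨R₁, L₁, h1⟩ := h1 U hU δ hδ ε hε
  obtain ⟨p₀, hp₀, R₃, L₃, h3⟩ := h3 U hU δ hδ
  refine ⟨U, hU, δ, hδ, ε * Real.sqrt p₀, by positivity, R₁ + R₂ + R₃, L₁ + L₂ + L₃, ?_⟩
  intro L _ hL hE ψ hψ hgs r hr e he e' he'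
  -- the bond-pair annihilators and the transplants
  set A : TorusSite 2 L → Site 2 → Matrix (Finset (Orb (FermionTorus 2 L))) (Finset (Orb (FermionTorus 2 L))) ℂ :=
    fun x u => annihilation (orb (FermionTorus.ofTorusSite x) 0) *
      annihilation (orb (FermionTorus.ofTorusSite (x + Torus.proj L u)) 1) with hA
  set T : TorusSite 2 L → Matrix (Finset (Orb (FermionTorus 2 L))) (Finset (Orb (FermionTorus 2 L))) ℂ :=
    fun x => (A x e)ᴴ * A (x + r) e' with hTdef
  have hT : ∀ v x : TorusSite 2 L, relabel (Orb.translate v) (T x) = T (x + v) := fun v x => by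
    simp only [hTdef, hA, relabel_mul, relabel_conjTranspose, relabel_translate_annihilation]
    rw [add_right_comm x (Torus.proj L e) v, add_right_comm (x + r) (Torus.proj L e') v, add_right_comm x r v]
  have hg : dWaveFormFactor e * dWaveFormFactor e' = 1 ∨ dWaveFormFactor e * dWaveFormFactor e' = -1 := by
    apply mul_self_eq_one_iff.1
    have h₁ := sq_dWaveFormFactor_eq_one he
    have h₂ := sq_dWaveFormFactor_eq_one he'
    nlinarith
  have hR₁ : R₁ ≤ torusDist r 0 := le_trans (by omega) hr
  have hR₂ : R₂ ≤ torusDist r 0 := le_trans (by omega) hr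
  have hR₃ : R₃ ≤ torusDist r 0 := le_trans (by omega) hr
  show 2 * (ε * Real.sqrt p₀) * (∑ x : TorusSite 2 L, ∑ τ : Finset (Orb (FermionTorus 2 L)), ‖ψ τ‖ * ‖(T x *ᵥ ψ) τ‖) ≤
    dWaveFormFactor e * dWaveFormFactor e' * ∑ x : TorusSite 2 L, (star ψ ⬝ᵥ (T x *ᵥ ψ)).re
  refine sign_coherence_of_bloch_forms 1 U _ 0 T hT _ hε hp₀ (fun φ hφ hφgs hb => ?_) (fun φ hφ hφgs hb => ?_) ψ hψ hgs
  · have a2 : 2 * ε * (∑ x : TorusSite 2 L, (star (T x *ᵥ φ) ⬝ᵥ (T x *ᵥ φ)).re) ≤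
        |∑ x : TorusSite 2 L, (star φ ⬝ᵥ (T x *ᵥ φ)).re| :=
      h2 L (by omega) hE φ hφ hφgs hb r hR₂ e he e' he'
    have a1 : 0 ≤ dWaveFormFactor e * dWaveFormFactor e' * ∑ x : TorusSite 2 L, (star φ ⬝ᵥ (T x *ᵥ φ)).re :=
      h1 L (by omega) hE φ hφ hφgs hb r hR₁ e he e' he' a2
    rcases hg with hg1 | hg1 <;> rw [hg1] at a1 ⊢
    · rw [one_mul] at a1 ⊢
      rwa [abs_of_nonneg a1] at a2
    · have hle : ∑ x : TorusSite 2 L, (star φ ⬝ᵥ (T x *ᵥ φ)).re ≤ 0 := by linarith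
      rw [abs_of_nonpos hle] at a2
      linarith
  · exact h3 L (by omega) hE φ hφ hφgs hb r hR₃ e he e' he'

/-- **The route's glue item `B1gSignCoherenceOfSubs`** (stmt-HubbardSuperconductivity-18072, route
`RelocationFloor`, rev ≥ 5): `DWaveChannelSelection → TransplantNondegeneracy → BlochPairSiteDensity →
B1gSignCoherence` for the route's OWN child decls (definitional unfolding of the three pieces into the
hypotheses of `B1gSignCoherence_of_subs`). [folklore] -/
theorem b1gSignCoherenceOfSubs :
    Summit.HubbardSuperconductivity.HubbardSuperconductivity.Theses.RelocationFloor.B1gSignCoherenceOfSubs :=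
  fun h1 h2 h3 => B1gSignCoherence_of_subs h1 h2 h3

end Summit.HubbardSuperconductivity.HubbardSuperconductivity.Theorems.RelocationFloor
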